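import Summits.RiemannHypothesis.RiemannHypothesis.Theorems.TiltedLandingLaw421R3Lens1ArcSignH

/-!
# TiltedLandingLaw421R3 — lens-1: DESCENT (part I): the disjunction at a NESTED zero of `f^{(j)}` gives the disjunction at `a`

LENS-1 gen-6 module image `rh33346-cover/lens-1/ArcSignI-v1.lean` (landing target `…/Theorems/TiltedLandingLaw421R3Lens1ArcSignI.lean`; single import =
part H; namespace `RhW08.Lens1ArcSign`; 0 `sorry`, no instances / notation; checked BY CHAIN over the ArcSign A–H images until tree).  O6-e mechanism
M1 of (CA575)/(CA582): RUNG 3 carries no `NoTallerToucher` hypothesis, so it applies at any zero `u` of the same `f^{(j)}`; if `u` is NESTED in `a`ʼs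
closed Jensen disc (`NestedIn a u : |Re u − Re a| + Im u ≤ Im a`), `u`ʼs closed disc and base lie in `a`ʼs (triangle inequality), so the disjunction at
`u` is the disjunction at `a`.

CONTENT: §1 `NestedIn`, `nestedIn_self`, `nestedStep_of_nestedIn` (the norm identity is the treeʼs `RhW08.SuccTheft.norm_sub_re_sq'`, inlined), `base_of_nestedIn`, ★ `pinning_descent` · §2 ★ `PinningOfNestedNetNonAscending`
(DESCENT RUNG: some nested zero `u` of `f^{(j)}`, `u = a` allowed, with net-non-ascending small circles ⇒ the disjunction at `a`) PROVED
(`pinning_of_nestedNetNonAscending`), `rung3_of_descent` (R3 ⊆ DESCENT) · §3 the residual `TopPinningNonNestedAscResidual` (no nested zero with a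
net-non-ascending word) and the exact split `topPinning_iff_nonNestedAscResidual : TopPinning ↔ TopPinningNonNestedAscResidual`.

HONEST LABEL / PRICE: a STRICT but SMALL shrink of the open class (crit-1: K < 0 class 1 511 → ≈ 1 163, the 348 nested-with-R3-word cases; instr-1: 24 →
19 registry-facing; 0/17 on N1+N2); NOT a paying rung for the crossing-mate class.  `TopPinning`, `TopPinningNonNestedAscResidual`, `RegUmbrella11S`, 33346,
33347 OPEN; nothing here bears on the truth of RH; RH is not proved; checked ≠ proved.
-/

noncomputable section

namespace RhW08.Lens1ArcSign

open Complex Set Metric Filter Topology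
open scoped Real
open Literature.Topology.PlaneTopology Literature.Analysis.Complex
open Summit.RiemannHypothesis.RiemannHypothesis.Theorems.Splittings.JensenWindow
open RhIdea6.G17.W07C7 RhIdea6.G17.W07C7.Rev6 RhIdea6.G18.W07C8.Law421BirthS RhIdea6.G19.W07C11.Seam
open RhIdea6.G20.W07C12.Frac RhIdea6.G20.W07C12.StColP RhW07.C12.FieldSplit RhIdea6.G21.W07C13.TentMax
open RhW07.C14.TwoSided RhW07.C14.Classes RhW07.C14.Lineage RhW07.C14.Booking
open RhW07.C13.Heredity RhIdea6.G22.W07C15pre.Injection RhW07.E3.Cell RhW07.E3.Lit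
open RhW08.Round1 RhW08.StSwap RhW08.Round2 RhW08.QuadW RhW08.SealSwapQ RhW08.SealSwap RhW08.SuccB RhW08.SuccSplit
open RhW08.SuccTheft RhW08.Column RhW08.Hurwitz RhW08.ClusterQ RhW08.ClusterQM RhW08.NewtonDoor RhW08.NewtonDoorGenusOne RhW08.PurseP
open RhW08.Lens1SignCut RhW08.Lens1Coverage RhW08.IsolatedTilt RhW08.Lens1Pinning RhW08.Lens1PinningIso

/-! ## §1 Nested zeros and descent -/

/-- `u` is NESTED in `a`ʼs closed Jensen disc: `|Re u − Re a| + Im u ≤ Im a` (so `u`ʼs closed Jensen disc and base lie in `a`ʼs). -/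
def NestedIn (a u : ℂ) : Prop := |u.re - a.re| + u.im ≤ a.im

/-- `a` is nested in itself (`|0| + Im a ≤ Im a`). -/
theorem nestedIn_self (a : ℂ) : NestedIn a a := by
  unfold NestedIn; simp

/-- A `NestedStep` child of a nested `u` (`Im u > 0`) is a `NestedStep` child of `a`. -/
theorem nestedStep_of_nestedIn {a u w : ℂ} (hu : 0 < u.im) (hn : NestedIn a u) (hw : NestedStep u w) : NestedStep a w := by
  unfold NestedStep at hw ⊢
  unfold NestedIn at hn
  have nsq : ∀ v : ℂ, ‖w - (v.re : ℂ)‖ ^ 2 = (w.re - v.re) ^ 2 + w.im ^ 2 := fun v => by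
    rw [Complex.sq_norm, Complex.normSq_apply]; simp; ring
  have h1 : ‖w - (u.re : ℂ)‖ ≤ u.im := by
    rw [← abs_norm, ← abs_of_pos hu]
    exact sq_le_sq.1 (by rw [nsq]; exact hw)
  have h2 : ‖w - (a.re : ℂ)‖ ≤ ‖w - (u.re : ℂ)‖ + |u.re - a.re| := by
    have e : w - (a.re : ℂ) = (w - (u.re : ℂ)) + ((u.re - a.re : ℝ) : ℂ) := by push_cast; ring
    rw [e]
    refine (norm_add_le _ _).trans ?_
    rw [Complex.norm_real, Real.norm_eq_abs]
  have h3 : ‖w - (a.re : ℂ)‖ ≤ a.im := by linarith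
  rw [← nsq]
  exact pow_le_pow_left₀ (norm_nonneg _) h3 2

/-- A base point of a nested `u` is a base point of `a`. -/
theorem base_of_nestedIn {a u : ℂ} {x : ℝ} (hn : NestedIn a u) (hx : |x - u.re| ≤ u.im) : |x - a.re| ≤ a.im := by
  unfold NestedIn at hn
  have := abs_sub_le x u.re a.re
  linarith

/-- DESCENT: the `TopPinning` disjunction at a nested zero `u` gives it at `a`. -/
theorem pinning_descent {f : ℂ → ℂ} {j : ℕ} {a u : ℂ} (hn : NestedIn a u) (hu : 0 < u.im)
    (h : (∃ w : ℂ, iteratedDeriv (j + 1) f w = 0 ∧ w.im ≠ 0 ∧ NestedStep u w) ∨ (∃ x : ℝ, |x - u.re| ≤ u.im ∧ NLEventOf f j x)) :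
    (∃ w : ℂ, iteratedDeriv (j + 1) f w = 0 ∧ w.im ≠ 0 ∧ NestedStep a w) ∨ (∃ x : ℝ, |x - a.re| ≤ a.im ∧ NLEventOf f j x) := by
  rcases h with ⟨w, hw0, hwim, hst⟩ | ⟨x, hx, hNL⟩
  · exact Or.inl ⟨w, hw0, hwim, nestedStep_of_nestedIn hu hn hst⟩
  · exact Or.inr ⟨x, base_of_nestedIn hn hx, hNL⟩

/-! ## §2 The descent rung -/

/-- ★ DESCENT RUNG (STATEMENT): some zero `u` of `f^{(j)}` nested in `a`ʼs closed Jensen disc (`u = a` allowed) whose small Jensen circles are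
net-non-ascending ⇒ the `TopPinning` disjunction at `a`. -/
def PinningOfNestedNetNonAscending : Prop :=
  ∀ (η : ℝ) (f : ℂ → ℂ) (x₀ s hmax R Hs : ℝ) (B : ℕ), EngineHyps5 2 η f x₀ s hmax R Hs B → ∀ (j : ℕ) (a : ℂ),
    iteratedDeriv j f a = 0 → 0 < a.im → (∃ u : ℂ, iteratedDeriv j f u = 0 ∧ 0 < u.im ∧ NestedIn a u ∧ ArcNetNonAsc f j u) →
    (∃ w : ℂ, iteratedDeriv (j + 1) f w = 0 ∧ w.im ≠ 0 ∧ NestedStep a w) ∨ (∃ x : ℝ, |x - a.re| ≤ a.im ∧ NLEventOf f j x)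

/-- ★ DESCENT RUNG PROVED from RUNG 3. -/
theorem pinning_of_nestedNetNonAscending : PinningOfNestedNetNonAscending := by
  intro η f x₀ s hmax R Hs B hE j a _ _ hU
  obtain ⟨u, hu0, hupos, hn, hNA⟩ := hU
  exact pinning_descent hn hupos (pinning_of_netNonAscending η f x₀ s hmax R Hs B hE j u hu0 hupos hNA)

/-- RUNG 3 ⊆ DESCENT RUNG (`u := a`). -/
theorem rung3_of_descent (hD : PinningOfNestedNetNonAscending) : PinningOfNetNonAscending :=
  fun η f x₀ s hmax R Hs B hE j a ha hapos hNA => hD η f x₀ s hmax R Hs B hE j a ha hapos ⟨a, ha, hapos, nestedIn_self a, hNA⟩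

/-! ## §3 The law is its non-nested-ascending residual -/

/-- The residual after DESCENT: the net-ascending residual of part F in which, moreover, NO zero `u` of `f^{(j)}` nested in `a`ʼs closed Jensen disc
(`u = a` included) has net-non-ascending small circles — the CROSSING-MATE class (every interior mate crosses `a`ʼs circle from inside, or the nested
ones are net-ascending all the way down).  OPEN. -/
def TopPinningNonNestedAscResidual : Prop :=
  ∀ (η : ℝ) (f : ℂ → ℂ) (x₀ s hmax R Hs : ℝ) (B : ℕ), EngineHyps5 2 η f x₀ s hmax R Hs B → ∀ (j : ℕ) (a : ℂ),
    iteratedDeriv j f a = 0 → 0 < a.im → NoTallerToucher f j a → ¬ JensenIsolated f j a → ¬ ArcSignClear f j a → ¬ ArcNoAsc f j a →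
    ¬ ArcNetNonAsc f j a → (∀ u : ℂ, iteratedDeriv j f u = 0 → 0 < u.im → NestedIn a u → ¬ ArcNetNonAsc f j u) →
    (∃ w : ℂ, iteratedDeriv (j + 1) f w = 0 ∧ w.im ≠ 0 ∧ NestedStep a w) ∨ (∃ x : ℝ, |x - a.re| ≤ a.im ∧ NLEventOf f j x)

/-- ★ EXACT SPLIT: the descent rung and the non-nested residual give part Fʼs net-ascending residual. -/
theorem netAscResidual_of_descent (hD : PinningOfNestedNetNonAscending) (h5 : TopPinningNonNestedAscResidual) :
    TopPinningNetAscResidual := by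
  intro η f x₀ s hmax R Hs B hE j a ha hapos hN hJ hS hA hM
  by_cases hex : ∃ u : ℂ, iteratedDeriv j f u = 0 ∧ 0 < u.im ∧ NestedIn a u ∧ ArcNetNonAsc f j u
  · exact hD η f x₀ s hmax R Hs B hE j a ha hapos hex
  · push Not at hex
    exact h5 η f x₀ s hmax R Hs B hE j a ha hapos hN hJ hS hA hM hex

/-- ★ The law from the descent rung and its residual. -/
theorem topPinning_of_nonNestedAscResidual (h5 : TopPinningNonNestedAscResidual) : TopPinning :=
  topPinning_of_netAscResidual (netAscResidual_of_descent pinning_of_nestedNetNonAscending h5)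

/-- Converse (bookkeeping): the split is exact. -/
theorem nonNestedAscResidual_of_topPinning (hP : TopPinning) : TopPinningNonNestedAscResidual :=
  fun η f x₀ s hmax R Hs B hE j a ha hapos hN _ _ _ _ _ => hP η f x₀ s hmax R Hs B hE j a ha hapos hN

/-- ★ `TopPinning ⟺ TopPinningNonNestedAscResidual`: after DESCENT the open content of the law is the crossing-mate class. -/
theorem topPinning_iff_nonNestedAscResidual : TopPinning ↔ TopPinningNonNestedAscResidual :=
  ⟨nonNestedAscResidual_of_topPinning, topPinning_of_nonNestedAscResidual⟩

/-- … and `TopPinningCrossing` from the same residual. -/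
theorem topPinningCrossing_of_nonNestedAscResidual (h5 : TopPinningNonNestedAscResidual) : TopPinningCrossing :=
  topPinningCrossing_of_netAscResidual (netAscResidual_of_descent pinning_of_nestedNetNonAscending h5)

end RhW08.Lens1ArcSign
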